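import Mathlib.Analysis.SpecialFunctions.Pow.Real
import Mathlib.Analysis.SpecialFunctions.Log.Basic
import Mathlib.Analysis.Convex.SpecificFunctions.Basic
import Literature.Computability.Complexity.SamplingGoodCodes
import Literature.Computability.Complexity.ACFourierTails
import Literature.Computability.Complexity.CircuitLowerBounds
import HarnessLib

/-!
# Proof of Lovett–Viola 2012, Theorem 1.1 (the named fact `lovettViola_goodCodes`)

Topic `Literature/Computability/Complexity`. This file discharges the named fact
`Literature.Computability.Complexity.lovettViola_goodCodes` of `SamplingGoodCodes.lean`
(`lovettViola_goodCodes_holds`): for constant depth `t`, polynomial size `q(n)` and rate/distance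
`≥ ρ n`, for all large `n`, every `F : {0,1}^m → {0,1}^n` computed output-bit-wise by AC⁰ circuits of
depth `≤ t` and size `≤ q(n)` and every `(n, k, d)`-code `C` with `k, d ≥ ρ n` satisfy
`Δ(F(U_m), U_C) ≥ 1/2`.

The proof follows S. Lovett, E. Viola, *Bounded-depth circuits cannot sample good codes*
(Comput. Complexity 21 (2012) 245–266 = ECCC TR10-115, read in the ECCC version), §2 and §4,
lemma by lemma, inside the grouping namespace `LovettViola`:

* **Definition 1** (`noiseWeight`, `noiseExp`, `boolNS`, `codeNS`): the `p`-biased noise `e ∼ μ_p`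
  on `{0,1}^m`, the noise expectation `𝔼_{x∼U_m, e∼μ_p}[φ(x, x+e)]` as a finite weighted sum, the
  noise sensitivity `NS_p(h)` of a Boolean function and `NS_p(F; C)` of a map w.r.t. a set.
* **Fact 10** (`noiseCorr_eq_sum_fourier`): `𝔼[f(x) g(x+e)] = ∑_T (1-2p)^{|T|} f̂(T) ĝ(T)` on top of
  the cube Fourier expansion of `BooleanFourier.lean`; hence (`boolNS_eq_sum_fourier`)
  `NS_p(h) = ½ ∑_T (1-(1-2p)^{|T|}) ĝ(T)²` for `g = χ ∘ h`.
* **Lemma 9** (AC⁰ has low noise sensitivity; printed from [LMN93, Bop97, Vio04]):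
  `boolNS_le_of_tail` (`NS_p ≤ pK + ½ W^{≥K+1}`) and `boolNS_circuit_le`, which feeds in the tree's
  proof of Tal's Fourier-tail theorem (`ACForm.tailWeight_le_tailBound`, `Circuit.exists_acForm` of
  `ACFourierTails.lean`) instead of Boppana's bound: `NS_p ≤ p · K + 2^{-(L+2)}` with the
  polylogarithmic cut-off `K = nsK t s L` (`nsK_le_polylog`). Only the polylog factor differs from
  the printed `O(p log^{t-1} M)`.
* **Lemma 6** (isoperimetric inequality for noise, due to Samorodnitsky): the lower bound
  `α² ≤ Pr[x ∈ A, x+e ∈ A]` is `sq_le_noiseCorr_self` (Fourier side of Fact 10). For the upper bound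
  the paper invokes the hypercontractivity theorem (Thm. 13) to get `α^{1/(1-p)}`; we prove the
  weaker exponent `Pr[x ∈ A, x+e ∈ B] ≤ (μ(A)μ(B))^{1/2+p/4}` (`noiseCorr_le_rpow`,
  `noiseCorr_indicator_le`) by induction on the dimension (`wsum_succ`) from an elementary two-point
  inequality (`twoPoint_norm`/`twoPoint_one`/`twoPoint_two`: Bernoulli's inequality for real
  exponents and a weighted Cauchy–Schwarz step). This changes only constants (`p = 8/k` below
  instead of `log(4/ε)/k`).
* **Claim 8, Corollary 7, Lemma 4** (`lemma4`, with `sum_sub_le_tvDist`, `toReal_sampledDist_apply`,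
  `sum_indicator_mem_eq`): for `ε = 1/2`, `Δ ≤ 1/2` and `(4/|C|)^{p/2} ≤ 1/8` force `NS_p(F;C) ≥ 1/32`.
* **Lemma 5** (`codeNS_le_sum_boolNS`): `NS_p(F; C) ≤ (1/d) ∑_i NS_p(F_i)`.
* **Theorem 1** (`lovettViola_goodCodes_holds`): with `p = 8/k`, `1/32 ≤ NS_p(F;C) ≤
  (n p K_n + 1/2)/d ≤ (8K_n/ρ + 1/2)/(ρ n)`, impossible for large `n` (`eventually_good`, from
  `Real.isLittleO_pow_log_id_atTop`).

## References

* S. Lovett, E. Viola, *Bounded-depth circuits cannot sample good codes*, Comput. Complexity 21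
  (2012) 245–266, doi:10.1007/s00037-012-0039-3; ECCC TR10-115 (Definition 1, Lemmas 4–6, 9,
  Corollary 7, Claim 8, Fact 10, Theorem 13) [LovettViola2012].
* E. Viola, *Extractors for circuit sources*, FOCS 2011 / SIAM J. Comput. 43 (2014), Lemma 3.1
  (restates Lemma 6) [Viola2014].
* A. Tal, *Tight bounds on the Fourier spectrum of AC⁰*, CCC 2017, Thm. 3.6 [Tal2017].
* R. O'Donnell, *Analysis of Boolean Functions*, CUP 2014, §1.4, §2.4, Ch. 9–10 [ODonnell2014].
-/

noncomputable section

namespace Literature.Computability.Complexity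

namespace LovettViola

open Finset Literature.Probability.RandomGraphs.LowDegree Literature.Computability.Complexity.LowDegree

variable {m : ℕ}

/-! ### Noise on the cube -/

/-- Bitwise xor `x + e`. [cite: LovettViola2012, Definition 1] -/
def bxor (x e : Fin m → Bool) : Fin m → Bool := fun i => xor (x i) (e i)

/-- The weight of the noise vector `e` under the `p`-biased product measure `μ_p`
(each bit is `1` independently with probability `p`). [cite: LovettViola2012, Definition 1] -/
def noiseWeight (p : ℝ) (e : Fin m → Bool) : ℝ := ∏ i, (if e i then p else 1 - p)

/-- Noise weights are nonnegative for `0 ≤ p ≤ 1`. [folklore] -/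
theorem noiseWeight_nonneg {p : ℝ} (hp0 : 0 ≤ p) (hp1 : p ≤ 1) (e : Fin m → Bool) :
    0 ≤ noiseWeight p e :=
  Finset.prod_nonneg fun i _ => by split_ifs <;> linarith

/-- A sum over noise vectors of a product of per-coordinate factors factors. [folklore] -/
theorem sum_prod_coord (w : Fin m → Bool → ℝ) :
    ∑ e : Fin m → Bool, ∏ i, w i (e i) = ∏ i, ∑ b : Bool, w i b := by
  have h := Finset.prod_univ_sum (fun _ : Fin m => (Finset.univ : Finset Bool)) w
  rw [Fintype.piFinset_univ] at h
  exact h.symm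

/-- `∑_e μ_p(e) = 1`. [folklore] -/
theorem sum_noiseWeight (p : ℝ) : ∑ e : Fin m → Bool, noiseWeight p e = 1 := by
  unfold noiseWeight
  refine (sum_prod_coord (fun (_ : Fin m) (b : Bool) => if b then p else 1 - p)).trans ?_
  simp

/-- Characters are multiplicative: `χ_T(x + e) = χ_T(x) χ_T(e)` (as `χ(a ⊕ b) = χ(a) χ(b)`).
[cite: LovettViola2012, §4] -/
theorem walsh_bxor (T : Finset (Fin m)) (x e : Fin m → Bool) :
    walsh T (bxor x e) = walsh T x * walsh T e := by
  unfold walsh bxor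
  rw [← Finset.prod_mul_distrib]
  exact Finset.prod_congr rfl fun i _ => by cases x i <;> cases e i <;> simp [sgn]

/-- `𝔼_{e∼μ_p} χ_T(e) = (1-2p)^{|T|}`. [cite: LovettViola2012, Fact 10] -/
theorem sum_noiseWeight_mul_walsh (p : ℝ) (T : Finset (Fin m)) :
    ∑ e : Fin m → Bool, noiseWeight p e * walsh T e = (1 - 2 * p) ^ T.card := by
  have key : ∀ e : Fin m → Bool, noiseWeight p e * walsh T e =
      ∏ i, ((if e i then p else 1 - p) * (if i ∈ T then sgn (e i) else 1)) := by
    intro e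
    rw [noiseWeight, walsh_eq_prod_ite, ← Finset.prod_mul_distrib]
  simp_rw [key]
  rw [sum_prod_coord (fun i b => (if b then p else 1 - p) * (if i ∈ T then sgn b else 1))]
  have : ∀ i : Fin m, ∑ b : Bool, (if b then p else 1 - p) * (if i ∈ T then sgn b else 1) =
      if i ∈ T then (1 - 2 * p) else 1 := by
    intro i
    by_cases hi : i ∈ T
    · simp [hi, sgn]; ring
    · simp [hi]
  simp_rw [this]
  rw [Finset.prod_ite_mem, Finset.univ_inter, Finset.prod_const]

/-- The noise expectation `𝔼_{x∼U_m, e∼μ_p} φ(x, x+e)` as a finite sum. [cite: LovettViola2012, Definition 1] -/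
def noiseExp (p : ℝ) (φ : (Fin m → Bool) → (Fin m → Bool) → ℝ) : ℝ :=
  (∑ x, ∑ e, noiseWeight p e * φ x (bxor x e)) / 2 ^ m

/-- Monotonicity of the noise expectation. [folklore] -/
theorem noiseExp_mono {p : ℝ} (hp0 : 0 ≤ p) (hp1 : p ≤ 1) {φ ψ : (Fin m → Bool) → (Fin m → Bool) → ℝ}
    (h : ∀ x y, φ x y ≤ ψ x y) : noiseExp p φ ≤ noiseExp p ψ := by
  unfold noiseExp
  refine div_le_div_of_nonneg_right ?_ (by positivity)
  exact Finset.sum_le_sum fun x _ => Finset.sum_le_sum fun e _ =>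
    mul_le_mul_of_nonneg_left (h _ _) (noiseWeight_nonneg hp0 hp1 e)

/-- Additivity of the noise expectation. [folklore] -/
theorem noiseExp_add (p : ℝ) (φ ψ : (Fin m → Bool) → (Fin m → Bool) → ℝ) :
    noiseExp p (fun x y => φ x y + ψ x y) = noiseExp p φ + noiseExp p ψ := by
  unfold noiseExp
  rw [← add_div, ← Finset.sum_add_distrib]
  congr 1
  refine Finset.sum_congr rfl fun x _ => ?_
  rw [← Finset.sum_add_distrib]
  refine Finset.sum_congr rfl fun e _ => ?_
  ring

/-- Subtractivity of the noise expectation. [folklore] -/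
theorem noiseExp_sub (p : ℝ) (φ ψ : (Fin m → Bool) → (Fin m → Bool) → ℝ) :
    noiseExp p (fun x y => φ x y - ψ x y) = noiseExp p φ - noiseExp p ψ := by
  unfold noiseExp
  rw [← sub_div, ← Finset.sum_sub_distrib]
  congr 1
  refine Finset.sum_congr rfl fun x _ => ?_
  rw [← Finset.sum_sub_distrib]
  refine Finset.sum_congr rfl fun e _ => ?_
  ring

/-- Homogeneity of the noise expectation. [folklore] -/
theorem noiseExp_const_mul (p c : ℝ) (φ : (Fin m → Bool) → (Fin m → Bool) → ℝ) :
    noiseExp p (fun x y => c * φ x y) = c * noiseExp p φ := by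
  unfold noiseExp
  rw [mul_div_assoc', Finset.mul_sum]
  congr 1
  refine Finset.sum_congr rfl fun x _ => ?_
  rw [Finset.mul_sum]
  refine Finset.sum_congr rfl fun e _ => ?_
  ring

/-- The noise expectation of a finite sum. [folklore] -/
theorem noiseExp_finset_sum {ι : Type*} (p : ℝ) (s : Finset ι) (φ : ι → (Fin m → Bool) → (Fin m → Bool) → ℝ) :
    noiseExp p (fun x y => ∑ i ∈ s, φ i x y) = ∑ i ∈ s, noiseExp p (φ i) := by
  classical
  induction s using Finset.induction_on with
  | empty =>
    simp [noiseExp]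
  | insert a s ha ih =>
    rw [Finset.sum_insert ha, ← ih]
    rw [← noiseExp_add]
    congr 1
    funext x y
    rw [Finset.sum_insert ha]

/-- The noise expectation of the constant `1` is `1`. [folklore] -/
theorem noiseExp_one (p : ℝ) : noiseExp p (fun (_ _ : Fin m → Bool) => (1 : ℝ)) = 1 := by
  unfold noiseExp
  simp_rw [mul_one, sum_noiseWeight]
  rw [Finset.sum_const, Finset.card_univ, Fintype.card_fun, Fintype.card_bool, Fintype.card_fin]
  simp

/-- The noise expectation is nonnegative on nonnegative integrands. [folklore] -/
theorem noiseExp_nonneg {p : ℝ} (hp0 : 0 ≤ p) (hp1 : p ≤ 1) {φ : (Fin m → Bool) → (Fin m → Bool) → ℝ}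
    (h : ∀ x y, 0 ≤ φ x y) : 0 ≤ noiseExp p φ := by
  unfold noiseExp
  refine div_nonneg (Finset.sum_nonneg fun x _ => Finset.sum_nonneg fun e _ => ?_) (by positivity)
  exact mul_nonneg (noiseWeight_nonneg hp0 hp1 e) (h _ _)

/-- A noise expectation whose integrand depends on `x` only is the uniform average. [folklore] -/
theorem noiseExp_left (p : ℝ) (u : (Fin m → Bool) → ℝ) :
    noiseExp p (fun x _ => u x) = (∑ x, u x) / 2 ^ m := by
  unfold noiseExp
  congr 1
  refine Finset.sum_congr rfl fun x _ => ?_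
  rw [← Finset.sum_mul, sum_noiseWeight, one_mul]

/-- The noise correlation `𝔼[f(x) g(x+e)]`. [cite: LovettViola2012, §4 (NS_p)] -/
def noiseCorr (p : ℝ) (f g : (Fin m → Bool) → ℝ) : ℝ := noiseExp p (fun x y => f x * g y)

/-- **Lovett–Viola 2012, Fact 10** (bilinear form): `𝔼_{x,e}[f(x) g(x+e)] = ∑_T (1-2p)^{|T|} f̂(T) ĝ(T)`.
[cite: LovettViola2012, Fact 10] -/
theorem noiseCorr_eq_sum_fourier (p : ℝ) (f g : (Fin m → Bool) → ℝ) :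
    noiseCorr p f g = ∑ T : Finset (Fin m), (1 - 2 * p) ^ T.card * (cubeFourierCoeff f T * cubeFourierCoeff g T) := by
  unfold noiseCorr noiseExp
  have h2 : (2 : ℝ) ^ m ≠ 0 := by positivity
  -- expand `g (x + e)` in the Fourier basis and average over `e`
  have inner : ∀ x : Fin m → Bool, ∑ e, noiseWeight p e * (f x * g (bxor x e)) =
      f x * ∑ T : Finset (Fin m), cubeFourierCoeff g T * (1 - 2 * p) ^ T.card * walsh T x := by
    intro x
    have eg : ∀ e, g (bxor x e) = ∑ T, cubeFourierCoeff g T * (walsh T x * walsh T e) := by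
      intro e
      rw [← sum_cubeFourierCoeff_mul_walsh g (bxor x e)]
      simp_rw [walsh_bxor]
    simp_rw [eg]
    calc ∑ e, noiseWeight p e * (f x * ∑ T, cubeFourierCoeff g T * (walsh T x * walsh T e))
        = f x * ∑ T, cubeFourierCoeff g T * walsh T x * ∑ e, noiseWeight p e * walsh T e := by
          simp_rw [Finset.mul_sum]
          rw [Finset.sum_comm]
          refine Finset.sum_congr rfl fun T _ => Finset.sum_congr rfl fun e _ => ?_
          ring
      _ = f x * ∑ T, cubeFourierCoeff g T * (1 - 2 * p) ^ T.card * walsh T x := by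
          congr 1
          refine Finset.sum_congr rfl fun T _ => ?_
          rw [sum_noiseWeight_mul_walsh]
          ring
  simp_rw [inner]
  simp_rw [Finset.mul_sum]
  rw [Finset.sum_comm, Finset.sum_div]
  refine Finset.sum_congr rfl fun T _ => ?_
  have : ∑ x, f x * (cubeFourierCoeff g T * (1 - 2 * p) ^ T.card * walsh T x) =
      (1 - 2 * p) ^ T.card * cubeFourierCoeff g T * ∑ x, f x * walsh T x := by
    rw [Finset.mul_sum]
    refine Finset.sum_congr rfl fun x _ => ?_
    ring
  rw [this, cubeFourierCoeff, cubeFourierCoeff]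
  field_simp

/-- The noise correlation of a function with itself dominates its squared mean (for `p ≤ 1/2`):
the first inequality of **Lovett–Viola 2012, Lemma 6**, `α² ≤ Pr[x ∈ A, x+e ∈ A]`, in functional form.
[cite: LovettViola2012, Lemma 6] -/
theorem sq_le_noiseCorr_self {p : ℝ} (hp : p ≤ 1 / 2) (f : (Fin m → Bool) → ℝ) :
    ((∑ x, f x) / 2 ^ m) ^ 2 ≤ noiseCorr p f f := by
  rw [noiseCorr_eq_sum_fourier, ← cubeFourierCoeff_empty]
  have h12 : 0 ≤ 1 - 2 * p := by linarith
  calc cubeFourierCoeff f ∅ ^ 2 = (1 - 2 * p) ^ (∅ : Finset (Fin m)).card * (cubeFourierCoeff f ∅ * cubeFourierCoeff f ∅) := by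
        simp [sq]
    _ ≤ ∑ T : Finset (Fin m), (1 - 2 * p) ^ T.card * (cubeFourierCoeff f T * cubeFourierCoeff f T) := by
        refine Finset.single_le_sum (f := fun T : Finset (Fin m) => (1 - 2 * p) ^ T.card * (cubeFourierCoeff f T * cubeFourierCoeff f T)) ?_ (Finset.mem_univ _)
        intro T _
        exact mul_nonneg (pow_nonneg h12 _) (mul_self_nonneg _)


/-! ### Noise sensitivity of a Boolean function through its Fourier tails -/

/-- The noise sensitivity `NS_p(h) = Pr_{x,e∼μ_p}[h(x) ≠ h(x+e)]` of a Boolean function.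
[cite: LovettViola2012, Definition 1 (case n = 1)] -/
def boolNS (p : ℝ) (h : (Fin m → Bool) → Bool) : ℝ :=
  noiseExp p (fun x y => if h x = h y then 0 else 1)

/-- `[h x ≠ h y] = (1 - χ(h x) χ(h y)) / 2`. [folklore] -/
theorem indicator_ne_eq_sgn (a b : Bool) :
    (if a = b then (0 : ℝ) else 1) = (1 - sgn a * sgn b) / 2 := by
  cases a <;> cases b <;> simp [sgn]

/-- Parseval for `{±1}`-valued functions: `∑_T ĝ(T)² = 1`. [cite: ODonnell2014, §1.4] -/
theorem sum_sq_cubeFourierCoeff_sgn (h : (Fin m → Bool) → Bool) :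
    ∑ T : Finset (Fin m), cubeFourierCoeff (fun x => sgn (h x)) T ^ 2 = 1 := by
  rw [sum_cubeFourierCoeff_sq]
  have : ∀ x : Fin m → Bool, sgn (h x) ^ 2 = 1 := fun x => by unfold sgn; split_ifs <;> norm_num
  simp only [this, Finset.sum_const, Finset.card_univ, Fintype.card_fun, Fintype.card_bool,
    Fintype.card_fin, nsmul_eq_mul, mul_one, Nat.cast_pow, Nat.cast_ofNat]
  rw [div_self (by positivity)]

/-- **Noise sensitivity in the Fourier basis**: `NS_p(h) = ½ ∑_T (1 - (1-2p)^{|T|}) ĝ(T)²` for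
`g = χ ∘ h` (Lovett–Viola 2012, Fact 10 with Parseval; O'Donnell 2014, Thm. 2.49). [cite: LovettViola2012, Fact 10] -/
theorem boolNS_eq_sum_fourier (p : ℝ) (h : (Fin m → Bool) → Bool) :
    boolNS p h = (∑ T : Finset (Fin m), (1 - (1 - 2 * p) ^ T.card) * cubeFourierCoeff (fun x => sgn (h x)) T ^ 2) / 2 := by
  have e1 : boolNS p h = noiseExp p (fun x y => (1 / 2) * 1 - (1 / 2) * (sgn (h x) * sgn (h y))) := by
    unfold boolNS; congr 1; funext x y; rw [indicator_ne_eq_sgn]; ring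
  rw [e1, noiseExp_sub, noiseExp_const_mul, noiseExp_const_mul, noiseExp_one]
  have e2 : noiseExp p (fun x y => sgn (h x) * sgn (h y)) = noiseCorr p (fun x => sgn (h x)) (fun x => sgn (h x)) := rfl
  rw [e2, noiseCorr_eq_sum_fourier]
  have e3 := sum_sq_cubeFourierCoeff_sgn h
  rw [Finset.sum_div]
  calc (1 : ℝ) / 2 * 1 - 1 / 2 * ∑ T : Finset (Fin m), (1 - 2 * p) ^ T.card *
        (cubeFourierCoeff (fun x => sgn (h x)) T * cubeFourierCoeff (fun x => sgn (h x)) T)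
      = 1 / 2 * (∑ T : Finset (Fin m), cubeFourierCoeff (fun x => sgn (h x)) T ^ 2) -
        1 / 2 * ∑ T : Finset (Fin m), (1 - 2 * p) ^ T.card * cubeFourierCoeff (fun x => sgn (h x)) T ^ 2 := by
          rw [e3]; congr 1; congr 1; refine Finset.sum_congr rfl fun T _ => ?_; ring
    _ = ∑ T : Finset (Fin m), (1 - (1 - 2 * p) ^ T.card) * cubeFourierCoeff (fun x => sgn (h x)) T ^ 2 / 2 := by
          rw [Finset.mul_sum, Finset.mul_sum, ← Finset.sum_sub_distrib]
          refine Finset.sum_congr rfl fun T _ => ?_; ring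

/-- **Noise sensitivity through the Fourier tail** (Lovett–Viola 2012, Lemma 9, proof idea [LMN93]):
`NS_p(h) ≤ p K + ½ W^{≥K+1}[χ ∘ h]` for every cut-off `K`, `0 ≤ p ≤ 1/2`. [cite: LovettViola2012, Lemma 9] -/
theorem boolNS_le_of_tail {p : ℝ} (hp0 : 0 ≤ p) (hp : p ≤ 1 / 2) (h : (Fin m → Bool) → Bool) (K : ℕ) :
    boolNS p h ≤ p * K + tailWeight (fun x => sgn (h x)) (K + 1) / 2 := by
  rw [boolNS_eq_sum_fourier]
  set g : (Fin m → Bool) → ℝ := fun x => sgn (h x) with hg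
  have hρ0 : 0 ≤ 1 - 2 * p := by linarith
  -- termwise bound
  have term : ∀ T : Finset (Fin m), (1 - (1 - 2 * p) ^ T.card) * cubeFourierCoeff g T ^ 2 / 2 ≤
      p * K * cubeFourierCoeff g T ^ 2 + (if K + 1 ≤ T.card then cubeFourierCoeff g T ^ 2 else 0) / 2 := by
    intro T
    have hsq : 0 ≤ cubeFourierCoeff g T ^ 2 := sq_nonneg _
    by_cases hT : K + 1 ≤ T.card
    · rw [if_pos hT]
      have h1 : 0 ≤ (1 - 2 * p) ^ T.card * cubeFourierCoeff g T ^ 2 := mul_nonneg (pow_nonneg hρ0 _) hsq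
      have h2 : 0 ≤ p * K * cubeFourierCoeff g T ^ 2 := by positivity
      nlinarith
    · rw [if_neg hT]
      have hc : (T.card : ℝ) ≤ K := by exact_mod_cast (by omega : T.card ≤ K)
      have hb := one_add_mul_le_pow (a := -(2 * p)) (by linarith) T.card
      have : 1 - (1 - 2 * p) ^ T.card ≤ 2 * p * T.card := by
        rw [show (1 : ℝ) + -(2 * p) = 1 - 2 * p by ring] at hb; linarith
      have h2 : 2 * p * (T.card : ℝ) ≤ 2 * p * K := by nlinarith
      nlinarith
  calc (∑ T : Finset (Fin m), (1 - (1 - 2 * p) ^ T.card) * cubeFourierCoeff g T ^ 2) / 2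
      = ∑ T : Finset (Fin m), (1 - (1 - 2 * p) ^ T.card) * cubeFourierCoeff g T ^ 2 / 2 := by rw [Finset.sum_div]
    _ ≤ ∑ T : Finset (Fin m), (p * K * cubeFourierCoeff g T ^ 2 + (if K + 1 ≤ T.card then cubeFourierCoeff g T ^ 2 else 0) / 2) :=
        Finset.sum_le_sum fun T _ => term T
    _ = p * K * ∑ T : Finset (Fin m), cubeFourierCoeff g T ^ 2 + (∑ T : Finset (Fin m), (if K + 1 ≤ T.card then cubeFourierCoeff g T ^ 2 else 0)) / 2 := by
        rw [Finset.sum_add_distrib, Finset.mul_sum, Finset.sum_div]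
    _ = p * K + tailWeight g (K + 1) / 2 := by
        rw [hg, sum_sq_cubeFourierCoeff_sgn h, mul_one, tailWeight, Finset.sum_filter]

/-! ### Noise sensitivity of small constant-depth circuits (from Tal's Fourier tail bound) -/

/-- The cut-off level used for a depth-`t`, size-`s` circuit and slack parameter `L`:
`K = B^{t+2} ℓ^t (3(t+2) + L + 1)`, `ℓ = ⌊log₂(2s+1)⌋`, `B = 16896`. [cite: LovettViola2012, Lemma 9] -/
def nsK (t s L : ℕ) : ℕ := ACForm.cB ^ (t + 2) * ACForm.logM (2 * s) ^ t * (3 * (t + 2) + L + 1)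

/-- **Lovett–Viola 2012, Lemma 9 (AC⁰ has low noise sensitivity), explicit variant**: a function computed
by a circuit over `acBasis` of `acDepth ≤ t` and size `≤ s` (`s ≥ 1`) has
`NS_p ≤ p · K + 2^{-(L+2)}` with `K = nsK t s L = polylog(s) · (L + O(t))`, for every `L` and
`0 ≤ p ≤ 1/2`. The printed lemma (from [LMN93, Bop97, Vio04 Lemma 6.6]) is `NS_p = O(p log^{t-1} M)`;
here it is derived from Tal's tail bound `ACForm.tailWeight_le_tailBound` of the tree, which changes
only the polylogarithmic factor. [cite: LovettViola2012, Lemma 9] -/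
theorem boolNS_circuit_le {p : ℝ} (hp0 : 0 ≤ p) (hp : p ≤ 1 / 2) (C : Circuit (Fin m)) (hC : C.IsOver acBasis)
    {t s : ℕ} (ht : C.acDepth ≤ t) (hs : C.size ≤ s) (hs1 : 1 ≤ s) (h : (Fin m → Bool) → Bool)
    (hCh : C.Computes h) (L : ℕ) :
    boolNS p h ≤ p * (nsK t s L) + 1 / 2 ^ (L + 2) := by
  obtain ⟨f, hev, hh, hw, hsize⟩ := C.exists_acForm hC
  have hM : 1 ≤ 2 * s := by omega
  have hℓ := ACForm.one_le_logM hM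
  set ℓ := ACForm.logM (2 * s) with hℓdef
  set K := nsK t s L with hK
  have htail := ACForm.tailWeight_le_tailBound (n := m) hM (t + 2) (by omega) f 1 le_rfl hℓ
    (by omega) (hsize.trans (by omega)) hw K
  have hfun : ACForm.sgnEval f = fun x => sgn (h x) := by
    funext x; rw [ACForm.sgnEval, hev x, hCh x]
  rw [hfun] at htail
  -- evaluate the tail bound at the cut-off
  have hbound : ACForm.tailBound ℓ (t + 2) 1 K = 1 / 2 ^ (L + 1) := by
    unfold ACForm.tailBound
    have hcB : (0 : ℝ) < (ACForm.cB : ℝ) := by unfold ACForm.cB ACForm.B0; norm_num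
    have hℓpos : (0 : ℝ) < (ℓ : ℝ) := by exact_mod_cast hℓ
    have hKe : (K : ℝ) = (ACForm.cB : ℝ) ^ (t + 2) * (ℓ : ℝ) ^ t * ((3 * (t + 2) + L + 1 : ℕ) : ℝ) := by
      rw [hK, nsK]; push_cast; ring
    have hexp : (K : ℝ) * Real.log 2 / ((ACForm.cB : ℝ) ^ (t + 2) * ((1 : ℕ) : ℝ) * (ℓ : ℝ) ^ (t + 2 - 2)) =
        ((3 * (t + 2) + L + 1 : ℕ) : ℝ) * Real.log 2 := by
      rw [hKe, show t + 2 - 2 = t by omega, Nat.cast_one, mul_one]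
      field_simp
    rw [hexp, Real.exp_neg, Real.exp_nat_mul, Real.exp_log two_pos]
    have hA : ((ACForm.cA : ℕ) : ℝ) ^ (t + 2) = 2 ^ (3 * (t + 2)) := by
      rw [pow_mul]; unfold ACForm.cA; norm_num
    rw [hA, show 3 * (t + 2) + L + 1 = 3 * (t + 2) + (L + 1) by omega, pow_add]
    field_simp
  rw [hbound] at htail
  have h1 := boolNS_le_of_tail hp0 hp h K
  have h2 := tailWeight_antitone (fun x => sgn (h x)) (Nat.le_succ K)
  have h3 : tailWeight (fun x => sgn (h x)) (K + 1) / 2 ≤ 1 / 2 ^ (L + 2) := by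
    rw [pow_succ]
    have := h2.trans htail
    rw [div_le_iff₀ (by norm_num : (0:ℝ) < 2)]
    calc tailWeight (fun x => sgn (h x)) (K + 1) ≤ 1 / 2 ^ (L + 1) := this
      _ = 1 / (2 ^ (L + 1) * 2) * 2 := by field_simp
  linarith


/-! ### The isoperimetric inequality for noise (Lemma 6, upper bound, weak exponent)

The printed proof of `Pr[x ∈ A, x+e ∈ A] ≤ α^{1/(1-p)}` is the hypercontractivity theorem
(Bonami–Beckner–Gross, Lovett–Viola 2012, Thm. 13). We prove instead the weaker exponent
`Pr[x ∈ A, x+e ∈ B] ≤ (μ(A) μ(B))^{1/2 + p/4}` by induction on the dimension, through an elementary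
two-point inequality (Bernoulli's inequality for real exponents and a weighted two-dimensional
Cauchy–Schwarz inequality); for the sampling lower bound only the form `α^{1+Ω(p)}` matters. -/

/-- The normalised one-function two-point inequality: for `0 ≤ p ≤ 1`, `|a| ≤ 1`, `r = 1 + p/2`,
`(1-p)((1+a)^r + (1-a)^r)/2 + p (1-a²)^{r/2} ≤ 1`. [cite: LovettViola2012, Theorem 13 (two-point case, weak exponent)] -/
theorem twoPoint_norm {p a : ℝ} (hp0 : 0 ≤ p) (hp1 : p ≤ 1) (ha1 : -1 ≤ a) (ha2 : a ≤ 1) :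
    (1 - p) * (((1 + a) ^ (1 + p / 2 : ℝ) + (1 - a) ^ (1 + p / 2 : ℝ)) / 2) +
      p * (1 - a ^ 2) ^ ((1 + p / 2) / 2 : ℝ) ≤ 1 := by
  have hκ0 : 0 ≤ p / 2 := by linarith
  have hκ1 : p / 2 ≤ 1 := by linarith
  have hne : (1 + p / 2 : ℝ) ≠ 0 := by intro h; linarith
  have h1a : 0 ≤ 1 + a := by linarith
  have h1a' : 0 ≤ 1 - a := by linarith
  have hB1 : (1 + a) ^ (1 + p / 2 : ℝ) ≤ (1 + a) * (1 + p / 2 * a) := by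
    rw [Real.rpow_add' h1a hne, Real.rpow_one]
    exact mul_le_mul_of_nonneg_left (rpow_one_add_le_one_add_mul_self ha1 hκ0 hκ1) h1a
  have hB2 : (1 - a) ^ (1 + p / 2 : ℝ) ≤ (1 - a) * (1 - p / 2 * a) := by
    have ha' : -1 ≤ -a := by linarith
    have hb := rpow_one_add_le_one_add_mul_self ha' hκ0 hκ1
    rw [Real.rpow_add' h1a' hne, Real.rpow_one]
    refine mul_le_mul_of_nonneg_left ?_ h1a'
    calc (1 - a) ^ (p / 2) = (1 + -a) ^ (p / 2) := by rw [← sub_eq_add_neg]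
      _ ≤ 1 + p / 2 * -a := hb
      _ = 1 - p / 2 * a := by ring
  have hsq : 0 ≤ 1 - a ^ 2 := by nlinarith
  have hsq1 : 1 - a ^ 2 ≤ 1 := by nlinarith
  have hC : (1 - a ^ 2) ^ ((1 + p / 2) / 2 : ℝ) ≤ 1 - a ^ 2 / 2 := by
    calc (1 - a ^ 2) ^ ((1 + p / 2) / 2 : ℝ) ≤ (1 - a ^ 2) ^ (1 / 2 : ℝ) :=
          Real.rpow_le_rpow_of_exponent_ge' hsq hsq1 (by norm_num) (by linarith)
      _ = Real.sqrt (1 - a ^ 2) := (Real.sqrt_eq_rpow _).symm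
      _ ≤ Real.sqrt ((1 - a ^ 2 / 2) ^ 2) := Real.sqrt_le_sqrt (by nlinarith)
      _ = 1 - a ^ 2 / 2 := Real.sqrt_sq (by nlinarith)
  have h1p : 0 ≤ 1 - p := by linarith
  calc (1 - p) * (((1 + a) ^ (1 + p / 2 : ℝ) + (1 - a) ^ (1 + p / 2 : ℝ)) / 2) +
        p * (1 - a ^ 2) ^ ((1 + p / 2) / 2 : ℝ)
      ≤ (1 - p) * (((1 + a) * (1 + p / 2 * a) + (1 - a) * (1 - p / 2 * a)) / 2) + p * (1 - a ^ 2 / 2) :=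
        add_le_add (mul_le_mul_of_nonneg_left (div_le_div_of_nonneg_right (add_le_add hB1 hB2) (by norm_num)) h1p)
          (mul_le_mul_of_nonneg_left hC hp0)
    _ = 1 - p ^ 2 * a ^ 2 / 2 := by ring
    _ ≤ 1 := by nlinarith [sq_nonneg (p * a)]

/-- The one-function two-point inequality, homogeneous form: for `α₀, α₁ ≥ 0`, `r = 1 + p/2`,
`(1-p)(α₀^r + α₁^r)/2 + p (α₀α₁)^{r/2} ≤ ((α₀+α₁)/2)^r`. [cite: LovettViola2012, Theorem 13 (two-point case, weak exponent)] -/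
theorem twoPoint_one {p α₀ α₁ : ℝ} (hp0 : 0 ≤ p) (hp1 : p ≤ 1) (h0 : 0 ≤ α₀) (h1 : 0 ≤ α₁) :
    (1 - p) * ((α₀ ^ (1 + p / 2 : ℝ) + α₁ ^ (1 + p / 2 : ℝ)) / 2) +
      p * (α₀ * α₁) ^ ((1 + p / 2) / 2 : ℝ) ≤ ((α₀ + α₁) / 2) ^ (1 + p / 2 : ℝ) := by
  have hne : (1 + p / 2 : ℝ) ≠ 0 := by intro h; linarith
  have hne2 : ((1 + p / 2) / 2 : ℝ) ≠ 0 := by intro h; linarith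
  by_cases hM : α₀ + α₁ = 0
  · have e0 : α₀ = 0 := by linarith
    have e1 : α₁ = 0 := by linarith
    subst e0; subst e1
    simp [Real.zero_rpow hne, Real.zero_rpow hne2]
  · have hMpos : 0 < (α₀ + α₁) / 2 := by
      rcases lt_or_eq_of_le (add_nonneg h0 h1) with h | h
      · linarith
      · exact absurd h.symm hM
    obtain ⟨M, a, hM0, ha1, ha2, e0, e1⟩ : ∃ M a : ℝ, 0 < M ∧ -1 ≤ a ∧ a ≤ 1 ∧
        α₀ = M * (1 + a) ∧ α₁ = M * (1 - a) := by
      refine ⟨(α₀ + α₁) / 2, (α₀ - α₁) / (α₀ + α₁), hMpos, ?_, ?_, ?_, ?_⟩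
      · rw [le_div_iff₀ (by linarith)]; linarith
      · rw [div_le_one (by linarith)]; linarith
      · field_simp; ring
      · field_simp; ring
    rw [e0, e1]
    have h1a : 0 ≤ 1 + a := by linarith
    have h1a' : 0 ≤ 1 - a := by linarith
    set r : ℝ := 1 + p / 2 with hr
    have r1 : (M * (1 + a)) ^ r = M ^ r * (1 + a) ^ r := Real.mul_rpow hM0.le h1a
    have r2 : (M * (1 - a)) ^ r = M ^ r * (1 - a) ^ r := Real.mul_rpow hM0.le h1a'
    have r3 : (M * (1 + a) * (M * (1 - a))) ^ (r / 2) = M ^ r * (1 - a ^ 2) ^ (r / 2) := by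
      rw [show M * (1 + a) * (M * (1 - a)) = (M * M) * (1 - a ^ 2) by ring,
        Real.mul_rpow (by positivity) (by nlinarith), Real.mul_rpow hM0.le hM0.le,
        ← Real.rpow_add hM0, show r / 2 + r / 2 = r by ring]
    have r4 : ((M * (1 + a) + M * (1 - a)) / 2) ^ r = M ^ r := by
      rw [show (M * (1 + a) + M * (1 - a)) / 2 = M by ring]
    rw [r1, r2, r3, r4]
    have key := twoPoint_norm hp0 hp1 ha1 ha2
    have hMr : 0 ≤ M ^ r := Real.rpow_nonneg hM0.le r
    calc (1 - p) * ((M ^ r * (1 + a) ^ r + M ^ r * (1 - a) ^ r) / 2) + p * (M ^ r * (1 - a ^ 2) ^ (r / 2))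
        = M ^ r * ((1 - p) * (((1 + a) ^ r + (1 - a) ^ r) / 2) + p * (1 - a ^ 2) ^ (r / 2)) := by ring
      _ ≤ M ^ r * 1 := mul_le_mul_of_nonneg_left key hMr
      _ = M ^ r := mul_one _

/-- The two-function two-point inequality: for `αᵢ, βᵢ ≥ 0`, `0 ≤ p ≤ 1/2`, `s = 1/2 + p/4`,
`½[(1-p)(α₀ˢβ₀ˢ + α₁ˢβ₁ˢ) + p(α₀ˢβ₁ˢ + α₁ˢβ₀ˢ)] ≤ ((α₀+α₁)/2)ˢ ((β₀+β₁)/2)ˢ` (the induction step of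
the noise isoperimetric inequality). [cite: LovettViola2012, Theorem 13 (two-point case, weak exponent)] -/
theorem twoPoint_two {p α₀ α₁ β₀ β₁ : ℝ} (hp0 : 0 ≤ p) (hp : p ≤ 1 / 2) (h0 : 0 ≤ α₀) (h1 : 0 ≤ α₁)
    (k0 : 0 ≤ β₀) (k1 : 0 ≤ β₁) :
    ((1 - p) * (α₀ ^ ((1 + p / 2) / 2 : ℝ) * β₀ ^ ((1 + p / 2) / 2 : ℝ) + α₁ ^ ((1 + p / 2) / 2 : ℝ) * β₁ ^ ((1 + p / 2) / 2 : ℝ)) +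
      p * (α₀ ^ ((1 + p / 2) / 2 : ℝ) * β₁ ^ ((1 + p / 2) / 2 : ℝ) + α₁ ^ ((1 + p / 2) / 2 : ℝ) * β₀ ^ ((1 + p / 2) / 2 : ℝ))) / 2 ≤
      ((α₀ + α₁) / 2) ^ ((1 + p / 2) / 2 : ℝ) * ((β₀ + β₁) / 2) ^ ((1 + p / 2) / 2 : ℝ) := by
  have hp1 : p ≤ 1 := by linarith
  set s : ℝ := (1 + p / 2) / 2 with hs
  set r : ℝ := 1 + p / 2 with hr
  have hrs : r = s * 2 := by rw [hs, hr]; ring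
  -- abbreviations
  set a₀ := α₀ ^ s; set a₁ := α₁ ^ s; set b₀ := β₀ ^ s; set b₁ := β₁ ^ s
  set A := ((α₀ + α₁) / 2) ^ s with hA
  set B := ((β₀ + β₁) / 2) ^ s with hB
  have ha₀ : 0 ≤ a₀ := Real.rpow_nonneg h0 s
  have ha₁ : 0 ≤ a₁ := Real.rpow_nonneg h1 s
  have hb₀ : 0 ≤ b₀ := Real.rpow_nonneg k0 s
  have hb₁ : 0 ≤ b₁ := Real.rpow_nonneg k1 s
  have hA0 : 0 ≤ A := Real.rpow_nonneg (by positivity) s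
  have hB0 : 0 ≤ B := Real.rpow_nonneg (by positivity) s
  -- squares of `s`-powers are `r`-powers
  have sqr : ∀ {x : ℝ}, 0 ≤ x → (x ^ s) ^ 2 = x ^ r := by
    intro x hx; rw [hrs, Real.rpow_mul hx, Real.rpow_two]
  have prd : ∀ {x y : ℝ}, 0 ≤ x → 0 ≤ y → x ^ s * y ^ s = (x * y) ^ (r / 2) := by
    intro x y hx hy; rw [← Real.mul_rpow hx hy, hrs]; ring_nf
  -- the one-function inequality for `α` and for `β`
  have hQa : (1 - p) * ((a₀ ^ 2 + a₁ ^ 2) / 2) + p * (a₀ * a₁) ≤ A ^ 2 := by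
    rw [sqr h0, sqr h1, prd h0 h1, sqr (by positivity)]
    exact twoPoint_one hp0 hp1 h0 h1
  have hQb : (1 - p) * ((b₀ ^ 2 + b₁ ^ 2) / 2) + p * (b₀ * b₁) ≤ B ^ 2 := by
    rw [sqr k0, sqr k1, prd k0 k1, sqr (by positivity)]
    exact twoPoint_one hp0 hp1 k0 k1
  -- weighted Cauchy–Schwarz in the eigenbasis `(a₀+a₁, a₀-a₁)`
  set ρ := 1 - 2 * p with hρ
  have hρ0 : 0 ≤ ρ := by rw [hρ]; linarith
  set X := (a₀ + a₁) * (b₀ + b₁) + ρ * ((a₀ - a₁) * (b₀ - b₁)) with hX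
  have hlhs : ((1 - p) * (a₀ * b₀ + a₁ * b₁) + p * (a₀ * b₁ + a₁ * b₀)) / 2 = X / 4 := by
    rw [hX, hρ]; ring
  have hQa' : (a₀ + a₁) ^ 2 + ρ * (a₀ - a₁) ^ 2 ≤ 4 * A ^ 2 := by
    have : (a₀ + a₁) ^ 2 + ρ * (a₀ - a₁) ^ 2 = 4 * ((1 - p) * ((a₀ ^ 2 + a₁ ^ 2) / 2) + p * (a₀ * a₁)) := by
      rw [hρ]; ring
    rw [this]; linarith
  have hQb' : (b₀ + b₁) ^ 2 + ρ * (b₀ - b₁) ^ 2 ≤ 4 * B ^ 2 := by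
    have : (b₀ + b₁) ^ 2 + ρ * (b₀ - b₁) ^ 2 = 4 * ((1 - p) * ((b₀ ^ 2 + b₁ ^ 2) / 2) + p * (b₀ * b₁)) := by
      rw [hρ]; ring
    rw [this]; linarith
  have hCS : X ^ 2 ≤ ((a₀ + a₁) ^ 2 + ρ * (a₀ - a₁) ^ 2) * ((b₀ + b₁) ^ 2 + ρ * (b₀ - b₁) ^ 2) := by
    have : ((a₀ + a₁) ^ 2 + ρ * (a₀ - a₁) ^ 2) * ((b₀ + b₁) ^ 2 + ρ * (b₀ - b₁) ^ 2) - X ^ 2 =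
        ρ * ((a₀ + a₁) * (b₀ - b₁) - (a₀ - a₁) * (b₀ + b₁)) ^ 2 := by
      rw [hX]; ring
    nlinarith [mul_nonneg hρ0 (sq_nonneg ((a₀ + a₁) * (b₀ - b₁) - (a₀ - a₁) * (b₀ + b₁)))]
  have hQa0 : 0 ≤ (a₀ + a₁) ^ 2 + ρ * (a₀ - a₁) ^ 2 := by positivity
  have hX2 : X ^ 2 ≤ (4 * (A * B)) ^ 2 := by
    calc X ^ 2 ≤ ((a₀ + a₁) ^ 2 + ρ * (a₀ - a₁) ^ 2) * ((b₀ + b₁) ^ 2 + ρ * (b₀ - b₁) ^ 2) := hCS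
      _ ≤ (4 * A ^ 2) * (4 * B ^ 2) := mul_le_mul hQa' hQb' (by positivity) (by positivity)
      _ = (4 * (A * B)) ^ 2 := by ring
  have hXle : X ≤ 4 * (A * B) := by
    have h4 : 0 ≤ 4 * (A * B) := by positivity
    exact abs_le_of_sq_le_sq' hX2 h4 |>.2
  rw [hlhs]
  linarith

/-! #### Splitting the cube `{0,1}^{m+1} = {0,1} × {0,1}^m` -/

/-- Sums over `{0,1}^{m+1}` split along the first coordinate. [folklore] -/
theorem sum_cube_succ (φ : (Fin (m + 1) → Bool) → ℝ) :
    ∑ x : Fin (m + 1) → Bool, φ x = ∑ b : Bool, ∑ y : Fin m → Bool, φ (Fin.cons b y) := by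
  rw [← (Fin.consEquiv (fun _ : Fin (m + 1) => Bool)).sum_comp, Fintype.sum_prod_type]
  rfl

/-- The noise weight factors along the first coordinate. [folklore] -/
theorem noiseWeight_cons (p : ℝ) (c : Bool) (e : Fin m → Bool) :
    noiseWeight p (Fin.cons c e : Fin (m + 1) → Bool) = (if c then p else 1 - p) * noiseWeight p e := by
  unfold noiseWeight
  rw [Fin.prod_univ_succ]
  simp only [Fin.cons_zero, Fin.cons_succ]

/-- Bitwise xor along the first coordinate. [folklore] -/
theorem bxor_cons (b c : Bool) (y e : Fin m → Bool) :
    bxor (Fin.cons b y : Fin (m + 1) → Bool) (Fin.cons c e) = Fin.cons (xor b c) (bxor y e) := by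
  funext i
  refine Fin.cases ?_ (fun j => ?_) i
  · simp [bxor]
  · simp [bxor]

/-- The unnormalised noise correlation sum `∑_x ∑_e μ_p(e) u(x) v(x+e)`. [cite: LovettViola2012, §4 (NS_p)] -/
def wsum (p : ℝ) (u v : (Fin m → Bool) → ℝ) : ℝ := ∑ x, ∑ e, noiseWeight p e * (u x * v (bxor x e))

/-- `noiseCorr = wsum / 2^m`. [folklore] -/
theorem noiseCorr_eq_wsum (p : ℝ) (u v : (Fin m → Bool) → ℝ) : noiseCorr p u v = wsum p u v / 2 ^ m := rfl

/-- **Recurrence** for the noise correlation sum along the first coordinate: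
`W_{m+1}(u,v) = ∑_b [(1-p) W_m(u_b, v_b) + p W_m(u_b, v_{¬b})]`. [folklore] -/
theorem wsum_succ (p : ℝ) (u v : (Fin (m + 1) → Bool) → ℝ) :
    wsum p u v = ∑ b : Bool, ((1 - p) * wsum p (fun y => u (Fin.cons b y)) (fun y => v (Fin.cons b y)) +
      p * wsum p (fun y => u (Fin.cons b y)) (fun y => v (Fin.cons (!b) y))) := by
  unfold wsum
  rw [sum_cube_succ]
  refine Finset.sum_congr rfl fun b _ => ?_
  have inner : ∀ y : Fin m → Bool, ∑ e : Fin (m + 1) → Bool, noiseWeight p e * (u (Fin.cons b y) * v (bxor (Fin.cons b y) e)) =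
      (1 - p) * ∑ e : Fin m → Bool, noiseWeight p e * (u (Fin.cons b y) * v (Fin.cons b (bxor y e))) +
      p * ∑ e : Fin m → Bool, noiseWeight p e * (u (Fin.cons b y) * v (Fin.cons (!b) (bxor y e))) := by
    intro y
    rw [sum_cube_succ]
    simp only [Fintype.sum_bool, noiseWeight_cons, bxor_cons, Bool.xor_true, Bool.xor_false,
      Bool.false_eq_true, if_true, if_false, Finset.mul_sum]
    rw [add_comm]
    congr 1 <;> refine Finset.sum_congr rfl fun e _ => ?_ <;> ring
  simp_rw [inner]
  rw [Finset.sum_add_distrib, ← Finset.mul_sum, ← Finset.mul_sum]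

/-- **Lovett–Viola 2012, Lemma 6 (upper bound), bilinear weak-exponent form**: for `0/1`-valued
`u, v` on `{0,1}^m` and `0 ≤ p ≤ 1/2`,
`𝔼_{x,e∼μ_p}[u(x) v(x+e)] ≤ (𝔼 u)^{1/2+p/4} (𝔼 v)^{1/2+p/4}`. [cite: LovettViola2012, Lemma 6] -/
theorem noiseCorr_le_rpow {p : ℝ} (hp0 : 0 ≤ p) (hp : p ≤ 1 / 2) :
    ∀ {m : ℕ} (u v : (Fin m → Bool) → ℝ), (∀ x, u x = 0 ∨ u x = 1) → (∀ x, v x = 0 ∨ v x = 1) →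
      noiseCorr p u v ≤ ((∑ x, u x) / 2 ^ m) ^ ((1 + p / 2) / 2 : ℝ) * ((∑ x, v x) / 2 ^ m) ^ ((1 + p / 2) / 2 : ℝ) := by
  have hsne : ((1 + p / 2) / 2 : ℝ) ≠ 0 := by intro h; linarith
  have h1p : 0 ≤ 1 - p := by linarith
  intro m
  induction m with
  | zero =>
    intro u v hu hv
    let z : Fin 0 → Bool := fun i => i.elim0
    have hw : noiseWeight p z = 1 := by simp [noiseWeight]
    have hb : bxor z z = z := Subsingleton.elim _ _
    rw [noiseCorr_eq_wsum, wsum]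
    simp only [Fintype.sum_subsingleton _ z, hw, hb, one_mul, pow_zero, div_one]
    rcases hu z with h | h <;> rcases hv z with h' | h' <;>
      simp [h, h', Real.zero_rpow hsne, Real.one_rpow]
  | succ m ih =>
    intro u v hu hv
    -- induction hypothesis on the four pairs of slices
    have i00 := ih (fun y => u (Fin.cons false y)) (fun y => v (Fin.cons false y)) (fun y => hu _) (fun y => hv _)
    have i11 := ih (fun y => u (Fin.cons true y)) (fun y => v (Fin.cons true y)) (fun y => hu _) (fun y => hv _)
    have i01 := ih (fun y => u (Fin.cons false y)) (fun y => v (Fin.cons true y)) (fun y => hu _) (fun y => hv _)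
    have i10 := ih (fun y => u (Fin.cons true y)) (fun y => v (Fin.cons false y)) (fun y => hu _) (fun y => hv _)
    rw [noiseCorr_eq_wsum] at i00 i11 i01 i10
    -- densities of the slices are nonnegative
    have h01 : ∀ (w : (Fin m → Bool) → ℝ), (∀ y, w y = 0 ∨ w y = 1) → 0 ≤ (∑ y, w y) / 2 ^ m := by
      intro w hw
      exact div_nonneg (Finset.sum_nonneg fun y _ => by rcases hw y with h | h <;> simp [h]) (by positivity)
    have hα₀ := h01 (fun y => u (Fin.cons false y)) (fun y => hu _)
    have hα₁ := h01 (fun y => u (Fin.cons true y)) (fun y => hu _)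
    have hβ₀ := h01 (fun y => v (Fin.cons false y)) (fun y => hv _)
    have hβ₁ := h01 (fun y => v (Fin.cons true y)) (fun y => hv _)
    have key := twoPoint_two hp0 hp hα₀ hα₁ hβ₀ hβ₁
    -- the total densities
    have hU : (∑ x, u x) / 2 ^ (m + 1) =
        ((∑ y, u (Fin.cons false y)) / 2 ^ m + (∑ y, u (Fin.cons true y)) / 2 ^ m) / 2 := by
      rw [sum_cube_succ, Fintype.sum_bool, pow_succ]
      field_simp
      ring
    have hV : (∑ x, v x) / 2 ^ (m + 1) =
        ((∑ y, v (Fin.cons false y)) / 2 ^ m + (∑ y, v (Fin.cons true y)) / 2 ^ m) / 2 := by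
      rw [sum_cube_succ, Fintype.sum_bool, pow_succ]
      field_simp
      ring
    rw [noiseCorr_eq_wsum, wsum_succ, Fintype.sum_bool, hU, hV]
    simp only [Bool.not_true, Bool.not_false]
    have step : (1 - p) * (wsum p (fun y => u (Fin.cons true y)) (fun y => v (Fin.cons true y)) / 2 ^ m +
          wsum p (fun y => u (Fin.cons false y)) (fun y => v (Fin.cons false y)) / 2 ^ m) +
        p * (wsum p (fun y => u (Fin.cons true y)) (fun y => v (Fin.cons false y)) / 2 ^ m +
          wsum p (fun y => u (Fin.cons false y)) (fun y => v (Fin.cons true y)) / 2 ^ m) ≤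
        (1 - p) * (((∑ y, u (Fin.cons true y)) / 2 ^ m) ^ ((1 + p / 2) / 2 : ℝ) * ((∑ y, v (Fin.cons true y)) / 2 ^ m) ^ ((1 + p / 2) / 2 : ℝ) +
          ((∑ y, u (Fin.cons false y)) / 2 ^ m) ^ ((1 + p / 2) / 2 : ℝ) * ((∑ y, v (Fin.cons false y)) / 2 ^ m) ^ ((1 + p / 2) / 2 : ℝ)) +
        p * (((∑ y, u (Fin.cons true y)) / 2 ^ m) ^ ((1 + p / 2) / 2 : ℝ) * ((∑ y, v (Fin.cons false y)) / 2 ^ m) ^ ((1 + p / 2) / 2 : ℝ) +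
          ((∑ y, u (Fin.cons false y)) / 2 ^ m) ^ ((1 + p / 2) / 2 : ℝ) * ((∑ y, v (Fin.cons true y)) / 2 ^ m) ^ ((1 + p / 2) / 2 : ℝ)) :=
      add_le_add (mul_le_mul_of_nonneg_left (add_le_add i11 i00) h1p) (mul_le_mul_of_nonneg_left (add_le_add i10 i01) hp0)
    have h2m : (2 : ℝ) ^ m ≠ 0 := by positivity
    calc _ = ((1 - p) * (wsum p (fun y => u (Fin.cons true y)) (fun y => v (Fin.cons true y)) / 2 ^ m +
          wsum p (fun y => u (Fin.cons false y)) (fun y => v (Fin.cons false y)) / 2 ^ m) +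
        p * (wsum p (fun y => u (Fin.cons true y)) (fun y => v (Fin.cons false y)) / 2 ^ m +
          wsum p (fun y => u (Fin.cons false y)) (fun y => v (Fin.cons true y)) / 2 ^ m)) / 2 := by
          rw [pow_succ]
          field_simp
          ring
      _ ≤ _ := by linarith [key, step]

/-- **Lovett–Viola 2012, Lemma 6 (upper bound, weak exponent), for sets**: for `A, B ⊆ {0,1}^m` and
`0 ≤ p ≤ 1/2`, `Pr_{x,e∼μ_p}[x ∈ A, x+e ∈ B] ≤ (μ(A) μ(B))^{1/2+p/4}`; in particular
`Pr[x ∈ A, x+e ∈ A] ≤ μ(A)^{1+p/2}` (printed: `≤ μ(A)^{1/(1-p)} ≤ μ(A)^{1+p}`, by hypercontractivity).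
[cite: LovettViola2012, Lemma 6] -/
theorem noiseCorr_indicator_le {p : ℝ} (hp0 : 0 ≤ p) (hp : p ≤ 1 / 2) (A : Finset (Fin m → Bool)) :
    noiseCorr p (fun x => if x ∈ A then 1 else 0) (fun x => if x ∈ A then 1 else 0) ≤
      ((A.card : ℝ) / 2 ^ m) ^ (1 + p / 2 : ℝ) := by
  have h := noiseCorr_le_rpow hp0 hp (fun x => if x ∈ A then (1:ℝ) else 0) (fun x => if x ∈ A then (1:ℝ) else 0)
    (fun x => by by_cases hx : x ∈ A <;> simp [hx]) (fun x => by by_cases hx : x ∈ A <;> simp [hx])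
  have hcard : (∑ x : Fin m → Bool, (if x ∈ A then (1:ℝ) else 0)) = A.card := by
    rw [Finset.sum_boole]; simp
  rw [hcard] at h
  refine h.trans (le_of_eq ?_)
  rw [← Real.rpow_add' (by positivity) (by intro h'; linarith)]
  ring_nf


/-! ### Output distributions, statistical distance, and Lemma 4 -/

section Sampling

variable {n : ℕ}

/-- The output distribution of `F` on uniform input, as a real density: `D(y) = |F⁻¹(y)| / 2^m`.
[cite: LovettViola2012, §2.1 (D = F(U_m))] -/
def dens (F : (Fin m → Bool) → (Fin n → Bool)) (y : Fin n → Bool) : ℝ :=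
  ((univ.filter (fun x => F x = y)).card : ℝ) / 2 ^ m

/-- `dens` is the density of the tree's `sampledDist`. [cite: LovettViola2012, §1 (sampling a distribution)] -/
theorem toReal_sampledDist_apply (F : (Fin m → Bool) → (Fin n → Bool)) (y : Fin n → Bool) :
    (sampledDist F y).toReal = dens F y := by
  rw [sampledDist, PMF.map_apply, tsum_fintype, dens]
  rw [Finset.sum_congr rfl (g := fun x => if F x = y then ((Fintype.card (Fin m → Bool) : ENNReal))⁻¹ else 0)
    (fun x _ => by
      rw [PMF.uniformOfFintype_apply]
      by_cases h : F x = y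
      · rw [if_pos h, if_pos h.symm]
      · rw [if_neg h, if_neg (Ne.symm h)])]
  rw [← Finset.sum_filter, Finset.sum_const, nsmul_eq_mul, ENNReal.toReal_mul, ENNReal.toReal_natCast,
    ENNReal.toReal_inv, ENNReal.toReal_natCast, Fintype.card_fun, Fintype.card_bool, Fintype.card_fin]
  push_cast
  rw [div_eq_mul_inv]

/-- `dens ≥ 0`. [folklore] -/
theorem dens_nonneg (F : (Fin m → Bool) → (Fin n → Bool)) (y : Fin n → Bool) : 0 ≤ dens F y := by
  unfold dens; positivity

/-- `∑_y D(y) = 1`. [folklore] -/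
theorem sum_dens (F : (Fin m → Bool) → (Fin n → Bool)) : ∑ y, dens F y = 1 := by
  simp_rw [← toReal_sampledDist_apply]
  exact sum_toReal_eq_one (sampledDist F)

/-- The uniform distribution on `C`, as a real density. [folklore] -/
theorem toReal_uniformOfFinset_apply (C : Finset (Fin n → Bool)) (hC : C.Nonempty) (y : Fin n → Bool) :
    (PMF.uniformOfFinset C hC y).toReal = if y ∈ C then 1 / (C.card : ℝ) else 0 := by
  rw [PMF.uniformOfFinset_apply]
  split_ifs
  · rw [ENNReal.toReal_inv, ENNReal.toReal_natCast, one_div]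
  · simp

/-- **Events under-weighted by at most the statistical distance**: for PMFs `P, Q` on the cube and any
set `E`, `Q(E) - P(E) ≤ Δ(P, Q)`. [cite: LovettViola2012, §1 (sd = max_S |Pr - Pr|)] -/
theorem sum_sub_le_tvDist (P Q : PMF (Fin n → Bool)) (E : Finset (Fin n → Bool)) :
    ∑ y ∈ E, ((Q y).toReal - (P y).toReal) ≤ P.tvDist Q := by
  rw [PMF.tvDist, tsum_fintype]
  have hP := sum_toReal_eq_one P
  have hQ := sum_toReal_eq_one Q
  have h1 : ∑ y ∈ E, ((Q y).toReal - (P y).toReal) ≤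
      ∑ y ∈ E, (|(P y).toReal - (Q y).toReal| + ((Q y).toReal - (P y).toReal)) / 2 := by
    refine Finset.sum_le_sum fun y _ => ?_
    have := neg_abs_le ((P y).toReal - (Q y).toReal)
    linarith
  have h2 : ∑ y ∈ E, (|(P y).toReal - (Q y).toReal| + ((Q y).toReal - (P y).toReal)) / 2 ≤
      ∑ y, (|(P y).toReal - (Q y).toReal| + ((Q y).toReal - (P y).toReal)) / 2 := by
    refine Finset.sum_le_sum_of_subset_of_nonneg (Finset.subset_univ E) fun y _ _ => ?_
    have := le_abs_self ((P y).toReal - (Q y).toReal)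
    linarith
  have h3 : ∑ y, (|(P y).toReal - (Q y).toReal| + ((Q y).toReal - (P y).toReal)) / 2 =
      2⁻¹ * ∑ y, |(P y).toReal - (Q y).toReal| := by
    rw [← Finset.sum_div, Finset.sum_add_distrib, Finset.sum_sub_distrib, hP, hQ]
    ring
  linarith

/-- The noise sensitivity of `F` with respect to a set `C` (Lovett–Viola 2012, Definition 1):
`NS_p(F; C) = Pr_{x,e∼μ_p}[F(x) ∈ C, F(x+e) ∈ C, F(x) ≠ F(x+e)]`. [cite: LovettViola2012, Definition 1] -/
def codeNS (p : ℝ) (F : (Fin m → Bool) → (Fin n → Bool)) (C : Finset (Fin n → Bool)) : ℝ :=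
  noiseExp p (fun x y => if F x ∈ C ∧ F y ∈ C ∧ F x ≠ F y then 1 else 0)

/-- **Lovett–Viola 2012, Lemma 5 (core inequality)**: if distinct elements of `C` are at Hamming
distance `≥ d ≥ 1`, then `NS_p(F; C) ≤ (1/d) ∑_i NS_p(F_i) = 𝔼[dist(F(x), F(x+e))]/d`. [cite: LovettViola2012, Lemma 5] -/
theorem codeNS_le_sum_boolNS {p : ℝ} (hp0 : 0 ≤ p) (hp1 : p ≤ 1) (F : (Fin m → Bool) → (Fin n → Bool))
    (C : Finset (Fin n → Bool)) {d : ℕ} (hd : 1 ≤ d)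
    (hdist : ∀ x ∈ C, ∀ y ∈ C, x ≠ y → d ≤ hammingDist x y) :
    codeNS p F C ≤ (∑ i : Fin n, boolNS p (fun x => F x i)) / d := by
  have hd0 : (0 : ℝ) < d := by exact_mod_cast hd
  unfold codeNS boolNS
  rw [← noiseExp_finset_sum, div_eq_inv_mul, ← noiseExp_const_mul]
  refine noiseExp_mono hp0 hp1 fun x y => ?_
  split_ifs with h
  · obtain ⟨hx, hy, hne⟩ := h
    have hle := hdist _ hx _ hy hne
    have hcard : (hammingDist (F x) (F y) : ℝ) = ∑ i : Fin n, (if F x i = F y i then (0:ℝ) else 1) := by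
      rw [hammingDist, Finset.card_filter]
      push_cast
      refine Finset.sum_congr rfl fun i _ => ?_
      by_cases h : F x i = F y i <;> simp [h]
    have : (d : ℝ) ≤ ∑ i : Fin n, (if F x i = F y i then (0:ℝ) else 1) := by
      rw [← hcard]; exact_mod_cast hle
    rw [le_inv_mul_iff₀ hd0]
    linarith
  · exact mul_nonneg (inv_nonneg.2 hd0.le) (Finset.sum_nonneg fun i _ => by split_ifs <;> norm_num)

/-- Fibre decomposition: `Pr_x[F(x) ∈ E] = ∑_{y ∈ E} D(y)`. [folklore] -/
theorem sum_indicator_mem_eq (F : (Fin m → Bool) → (Fin n → Bool)) (E : Finset (Fin n → Bool)) :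
    (∑ x : Fin m → Bool, (if F x ∈ E then (1:ℝ) else 0)) / 2 ^ m = ∑ y ∈ E, dens F y := by
  unfold dens
  rw [← Finset.sum_div]
  congr 1
  have e : ∀ x : Fin m → Bool, (if F x ∈ E then (1:ℝ) else 0) = ∑ y ∈ E, (if F x = y then (1:ℝ) else 0) := by
    intro x; rw [Finset.sum_ite_eq]
  simp_rw [e]
  rw [Finset.sum_comm]
  refine Finset.sum_congr rfl fun y _ => ?_
  rw [Finset.sum_boole]

/-- **Lovett–Viola 2012, Lemma 4 (with Claim 8 and Corollary 7), for `ε = 1/2` and the weak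
isoperimetric exponent**: if `Δ(F(U_m), U_C) ≤ 1/2` and `(4/|C|)^{p/2} ≤ 1/8`, `0 ≤ p ≤ 1/2`, then
`NS_p(F; C) ≥ 1/32`. (Printed: `Δ ≤ 1 - ε`, `|S| ≥ (4/ε)^{1/p}` give `NS_p ≥ ε²/8`.) [cite: LovettViola2012, Lemma 4] -/
theorem lemma4 {p : ℝ} (hp0 : 0 ≤ p) (hp : p ≤ 1 / 2) (F : (Fin m → Bool) → (Fin n → Bool))
    (C : Finset (Fin n → Bool)) (hC : C.Nonempty)
    (hsmall : ((4 : ℝ) / C.card) ^ (p / 2) ≤ 1 / 8)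
    (htv : (sampledDist F).tvDist (PMF.uniformOfFinset C hC) ≤ 1 / 2) :
    (1 : ℝ) / 32 ≤ codeNS p F C := by
  have hp1 : p ≤ 1 := by linarith
  set N : ℝ := (C.card : ℝ) with hN
  have hNpos : 0 < N := by rw [hN]; exact_mod_cast hC.card_pos
  -- Claim 8: the light codewords
  set E := C.filter (fun y => dens F y ≤ 4 / N) with hE
  set E' := C.filter (fun y => ¬ dens F y ≤ 4 / N) with hE'
  have hEC : E ⊆ C := Finset.filter_subset _ _
  have hcardEE' : (E.card : ℝ) + E'.card = N := by
    rw [hN, hE, hE']; exact_mod_cast Finset.card_filter_add_card_filter_not _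
  have hE'small : (E'.card : ℝ) * (4 / N) ≤ 1 := by
    calc (E'.card : ℝ) * (4 / N) = ∑ y ∈ E', (4 / N) := by rw [Finset.sum_const, nsmul_eq_mul]
      _ ≤ ∑ y ∈ E', dens F y := Finset.sum_le_sum fun y hy => by
          have := (Finset.mem_filter.1 hy).2; push Not at this; exact this.le
      _ ≤ ∑ y, dens F y := Finset.sum_le_sum_of_subset_of_nonneg (Finset.subset_univ _) fun y _ _ => dens_nonneg F y
      _ = 1 := sum_dens F
  have hUE : (3 : ℝ) / 4 ≤ ∑ y ∈ E, (PMF.uniformOfFinset C hC y).toReal := by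
    have : ∑ y ∈ E, (PMF.uniformOfFinset C hC y).toReal = E.card / N := by
      rw [Finset.sum_congr rfl (g := fun _ => 1 / N) fun y hy => by
        rw [toReal_uniformOfFinset_apply, if_pos (hEC hy)]]
      rw [Finset.sum_const, nsmul_eq_mul, hN]; ring
    rw [this, div_le_div_iff₀ (by norm_num) hNpos]
    have : (E'.card : ℝ) * 4 ≤ N := by
      have := hE'small; rw [mul_div_assoc', div_le_one hNpos] at this; linarith
    nlinarith
  have hDE : (1 : ℝ) / 4 ≤ ∑ y ∈ E, dens F y := by
    have h := sum_sub_le_tvDist (sampledDist F) (PMF.uniformOfFinset C hC) E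
    rw [Finset.sum_sub_distrib] at h
    simp_rw [toReal_sampledDist_apply] at h
    linarith
  -- the good inputs and their noise stability
  set u : (Fin m → Bool) → ℝ := fun x => if F x ∈ E then 1 else 0 with hu
  have hμ : (∑ x, u x) / 2 ^ m = ∑ y ∈ E, dens F y := sum_indicator_mem_eq F E
  have hboth : (∑ y ∈ E, dens F y) ^ 2 ≤ noiseExp p (fun x y => u x * u y) := by
    rw [← hμ]; exact sq_le_noiseCorr_self hp u
  -- collisions inside a fibre
  have hcoll : noiseExp p (fun x y => if F x ∈ E ∧ F y = F x then (1:ℝ) else 0) ≤ (1 / 8) * ∑ y ∈ E, dens F y := by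
    have e : (fun x y => if F x ∈ E ∧ F y = F x then (1:ℝ) else 0) =
        fun x y => ∑ z ∈ E, (if F x = z then (1:ℝ) else 0) * (if F y = z then 1 else 0) := by
      funext x y
      by_cases hx : F x ∈ E
      · rw [← Finset.add_sum_erase E _ hx, if_pos rfl, one_mul]
        rw [Finset.sum_eq_zero (fun z hz => by rw [if_neg (Finset.ne_of_mem_erase hz).symm, zero_mul]), add_zero]
        by_cases hy : F y = F x <;> simp [hx, hy]
      · rw [if_neg (fun h => hx h.1)]
        refine (Finset.sum_eq_zero fun z hz => ?_).symm
        rw [if_neg (fun h : F x = z => hx (by rw [h]; exact hz)), zero_mul]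
    rw [e, noiseExp_finset_sum, Finset.mul_sum]
    refine Finset.sum_le_sum fun z hz => ?_
    have hzE := (Finset.mem_filter.1 hz).2
    have hiso := noiseCorr_indicator_le hp0 hp (univ.filter (fun x => F x = z))
    have e2 : (fun x : Fin m → Bool => if x ∈ univ.filter (fun x => F x = z) then (1:ℝ) else 0) = fun x => if F x = z then 1 else 0 := by
      funext x; simp
    rw [e2] at hiso
    change noiseCorr p (fun x => if F x = z then (1:ℝ) else 0) (fun x => if F x = z then 1 else 0) ≤ _
    refine hiso.trans ?_
    change dens F z ^ (1 + p / 2) ≤ 1 / 8 * dens F z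
    have hdz := dens_nonneg F z
    rw [Real.rpow_add' hdz (by intro h; linarith), Real.rpow_one, mul_comm]
    refine mul_le_mul_of_nonneg_right ?_ hdz
    exact (Real.rpow_le_rpow hdz hzE (by linarith)).trans hsmall
  -- Corollary 7 assembled
  have hlower : noiseExp p (fun x y => u x * u y) - noiseExp p (fun x y => if F x ∈ E ∧ F y = F x then (1:ℝ) else 0) ≤ codeNS p F C := by
    rw [← noiseExp_sub]
    refine noiseExp_mono hp0 hp1 fun x y => ?_
    have hR : (0:ℝ) ≤ (if F x ∈ C ∧ F y ∈ C ∧ F x ≠ F y then (1:ℝ) else 0) := by split_ifs <;> norm_num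
    simp only [hu]
    by_cases hx : F x ∈ E
    · by_cases hy : F y ∈ E
      · by_cases hxy : F y = F x
        · have hn : ¬ (F x ∈ C ∧ F y ∈ C ∧ F x ≠ F y) := fun h => h.2.2 hxy.symm
          rw [if_pos hx, if_pos hy, if_pos ⟨hx, hxy⟩, if_neg hn]; norm_num
        · rw [if_pos hx, if_pos hy, if_neg (fun h => hxy h.2), if_pos ⟨hEC hx, hEC hy, fun h => hxy h.symm⟩]; norm_num
      · have hn : ¬ (F x ∈ E ∧ F y = F x) := fun h => hy (by rw [h.2]; exact hx)
        rw [if_pos hx, if_neg hy, if_neg hn]; linarith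
    · have hn : ¬ (F x ∈ E ∧ F y = F x) := fun h => hx h.1
      rw [if_neg hx, if_neg hn]; linarith
  set μ := ∑ y ∈ E, dens F y with hμdef
  have : μ ^ 2 - (1 / 8) * μ ≤ codeNS p F C := by linarith
  nlinarith

end Sampling


/-! ### Asymptotics: the cut-off is polylogarithmic -/

/-- **The cut-off is polylogarithmic**: for `s = max(2, q(n))` and `L = ⌊log₂ n⌋`,
`nsK t s L ≤ A · (ln n)^{t+1}` for `n ≥ 3`, with `A` depending on `t, q` only. [cite: LovettViola2012, Theorem 1 (M = poly(n), t = O(1))] -/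
theorem nsK_le_polylog (t : ℕ) (q : Polynomial ℕ) : ∃ A : ℝ, 0 < A ∧ ∀ n : ℕ, 3 ≤ n →
    (nsK t (max 2 (q.eval n)) (Nat.log 2 n) : ℝ) ≤ A * Real.log n ^ (t + 1) := by
  set D := q.natDegree with hD
  set Q : ℕ := q.eval 1 + 2 with hQ
  have hQ2 : (2 : ℝ) ≤ Q := by rw [hQ]; push_cast; linarith [(Nat.cast_nonneg (q.eval 1) : (0:ℝ) ≤ _)]
  have hlogQ : 0 ≤ Real.log Q := Real.log_nonneg (by linarith)
  refine ⟨(ACForm.cB : ℝ) ^ (t + 2) * (5 * (Real.log Q + D)) ^ t * (3 * (t + 2) + 3), ?_, ?_⟩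
  · have hlogQpos : 0 < Real.log Q := Real.log_pos (by linarith)
    have h1 : (0:ℝ) < (ACForm.cB : ℝ) ^ (t + 2) := by unfold ACForm.cB ACForm.B0; positivity
    have h2 : (0:ℝ) < (5 * (Real.log Q + D)) ^ t :=
      pow_pos (mul_pos (by norm_num) (add_pos_of_pos_of_nonneg hlogQpos (Nat.cast_nonneg D))) t
    exact mul_pos (mul_pos h1 h2) (by positivity)
  intro n hn
  have hn1 : 1 ≤ n := by omega
  have hnR : (3 : ℝ) ≤ n := by exact_mod_cast hn
  have hlogn : 1 ≤ Real.log n := by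
    rw [← Real.log_exp 1]
    refine Real.log_le_log (Real.exp_pos 1) (le_trans ?_ hnR)
    have := Real.exp_one_lt_d9; linarith
  -- size bound
  set s := max 2 (q.eval n) with hs
  have hs2 : 2 ≤ s := le_max_left _ _
  have hsQ : (s : ℝ) ≤ Q * (n : ℝ) ^ D := by
    have h1 : q.eval n ≤ q.eval 1 * n ^ D := natPoly_eval_le_eval_one_mul_pow q hn1
    have h2 : s ≤ Q * n ^ D := by
      rw [hs, hQ]
      refine max_le ?_ (h1.trans (Nat.mul_le_mul_right _ (by omega)))
      calc 2 ≤ 2 * n ^ D := by nlinarith [Nat.one_le_pow D n hn1]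
        _ ≤ (q.eval 1 + 2) * n ^ D := Nat.mul_le_mul_right _ (by omega)
    exact_mod_cast h2
  have hlogs : Real.log s ≤ (Real.log Q + D) * Real.log n := by
    have hspos : (0 : ℝ) < s := by exact_mod_cast (show 0 < s by omega)
    calc Real.log s ≤ Real.log (Q * (n : ℝ) ^ D) := Real.log_le_log hspos hsQ
      _ = Real.log Q + D * Real.log n := by
          rw [Real.log_mul (by positivity) (by positivity), Real.log_pow]
      _ ≤ Real.log Q * Real.log n + D * Real.log n := by nlinarith
      _ = (Real.log Q + D) * Real.log n := by ring
  have hℓ : (ACForm.logM (2 * s) : ℝ) ≤ 5 * (Real.log Q + D) * Real.log n := by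
    have := ACForm.logM_two_mul_le hs2
    nlinarith
  have hL : ((3 * (t + 2) + Nat.log 2 n + 1 : ℕ) : ℝ) ≤ (3 * (t + 2) + 3) * Real.log n := by
    -- `⌊log₂ n⌋ ≤ 2 ln n`
    have hlog2n : (Nat.log 2 n : ℝ) ≤ 2 * Real.log n := by
      have hpow : (2 : ℝ) ^ Nat.log 2 n ≤ n := by exact_mod_cast Nat.pow_log_le_self 2 (by omega)
      have h1 : (Nat.log 2 n : ℝ) * Real.log 2 ≤ Real.log n := by
        rw [← Real.log_pow]; exact Real.log_le_log (by positivity) hpow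
      have hl2 := Real.log_two_gt_d9
      nlinarith
    push_cast
    nlinarith
  have hℓ0 : (0 : ℝ) ≤ (ACForm.logM (2 * s) : ℝ) := Nat.cast_nonneg _
  rw [nsK]
  push_cast
  have hcB : (0 : ℝ) ≤ (ACForm.cB : ℝ) ^ (t + 2) := by positivity
  calc (ACForm.cB : ℝ) ^ (t + 2) * (ACForm.logM (2 * s) : ℝ) ^ t * (3 * ((t : ℝ) + 2) + (Nat.log 2 n : ℝ) + 1)
      ≤ (ACForm.cB : ℝ) ^ (t + 2) * (5 * (Real.log Q + D) * Real.log n) ^ t * ((3 * (t + 2) + 3) * Real.log n) := by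
        have e : (3 * ((t : ℝ) + 2) + (Nat.log 2 n : ℝ) + 1) = ((3 * (t + 2) + Nat.log 2 n + 1 : ℕ) : ℝ) := by push_cast; ring
        rw [e]
        gcongr
    _ = (ACForm.cB : ℝ) ^ (t + 2) * (5 * (Real.log Q + D)) ^ t * (3 * (t + 2) + 3) * Real.log n ^ (t + 1) := by
        rw [mul_pow, pow_succ]; ring

/-- The eventual numerical condition behind the theorem: for large `n`, `ρ n ≥ 16` and
`32 (8 K_n / ρ + 1/2) < ρ n`. [cite: LovettViola2012, Theorem 1 ("in particular")] -/
theorem eventually_good (t : ℕ) (q : Polynomial ℕ) {ρ : ℝ} (hρ : 0 < ρ) :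
    ∀ᶠ n : ℕ in Filter.atTop, (16 : ℝ) ≤ ρ * n ∧
      32 * (8 * (nsK t (max 2 (q.eval n)) (Nat.log 2 n) : ℝ) / ρ + 1 / 2) < ρ * n := by
  obtain ⟨A, hA, hK⟩ := nsK_le_polylog t q
  have hc : 0 < ρ ^ 2 / (512 * A) := by positivity
  have h1 : ∀ᶠ x : ℝ in Filter.atTop, ‖Real.log x ^ (t + 1)‖ ≤ ρ ^ 2 / (512 * A) * ‖x‖ :=
    (Real.isLittleO_pow_log_id_atTop (n := t + 1)).bound hc
  have h2 := tendsto_natCast_atTop_atTop.eventually h1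
  have h3 : ∀ᶠ n : ℕ in Filter.atTop, 3 ≤ n := Filter.eventually_ge_atTop 3
  have h4 : ∀ᶠ n : ℕ in Filter.atTop, (32 : ℝ) < ρ * n :=
    (tendsto_natCast_atTop_atTop.const_mul_atTop hρ).eventually_gt_atTop 32
  filter_upwards [h2, h3, h4] with n h2 h3 h4
  have hn0 : (0 : ℝ) ≤ n := Nat.cast_nonneg n
  have hlog0 : 0 ≤ Real.log n := Real.log_nonneg (by exact_mod_cast (show 1 ≤ n by omega))
  rw [Real.norm_eq_abs, Real.norm_eq_abs, abs_of_nonneg (pow_nonneg hlog0 _), abs_of_nonneg hn0] at h2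
  have hKn := hK n h3
  refine ⟨by linarith, ?_⟩
  have : (nsK t (max 2 (q.eval n)) (Nat.log 2 n) : ℝ) ≤ A * (ρ ^ 2 / (512 * A) * n) :=
    hKn.trans (mul_le_mul_of_nonneg_left h2 hA.le)
  have e : A * (ρ ^ 2 / (512 * A) * n) = ρ ^ 2 * n / 512 := by field_simp
  rw [e] at this
  rw [mul_add, mul_div_assoc]
  have : 32 * (8 * ((nsK t (max 2 (Polynomial.eval n q)) (Nat.log 2 n) : ℝ) / ρ)) ≤ ρ * n / 2 := by
    rw [show 32 * (8 * ((nsK t (max 2 (Polynomial.eval n q)) (Nat.log 2 n) : ℝ) / ρ)) =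
      256 * (nsK t (max 2 (Polynomial.eval n q)) (Nat.log 2 n) : ℝ) / ρ by ring]
    rw [div_le_iff₀ hρ]
    nlinarith
  linarith

/-! ### Assembly: Theorem 1.1, "in particular" clause -/

/-- `(4/2^k)^{4/k} ≤ 1/8` for `k ≥ 8`. [folklore] -/
theorem small_param {k : ℕ} (hk : 8 ≤ k) : ((4 : ℝ) / (2 : ℝ) ^ k) ^ ((8 / (k : ℝ)) / 2) ≤ 1 / 8 := by
  have hkpos : (0 : ℝ) < k := by exact_mod_cast (show 0 < k by omega)
  have e1 : (4 : ℝ) / (2 : ℝ) ^ k = (2 : ℝ) ^ ((2 : ℝ) - k) := by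
    rw [Real.rpow_sub two_pos, Real.rpow_natCast, Real.rpow_two]; norm_num
  rw [e1, ← Real.rpow_mul (by norm_num : (0:ℝ) ≤ 2)]
  have e2 : ((2 : ℝ) - k) * (8 / (k : ℝ) / 2) = 8 / k - 4 := by field_simp; ring
  rw [e2]
  have h3 : (8 : ℝ) / k - 4 ≤ -3 := by
    have : (8 : ℝ) / k ≤ 1 := by rw [div_le_one hkpos]; exact_mod_cast hk
    linarith
  calc (2 : ℝ) ^ ((8 : ℝ) / k - 4) ≤ (2 : ℝ) ^ (-3 : ℝ) := Real.rpow_le_rpow_of_exponent_le (by norm_num) h3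
    _ = 1 / 8 := by
        rw [show (-3 : ℝ) = -((3 : ℕ) : ℝ) by norm_num, Real.rpow_neg (by norm_num), Real.rpow_natCast]; norm_num

end LovettViola

open LovettViola in
/-- **Lovett–Viola 2012, Theorem 1.1 ("in particular" clause, weak eventual form)**: discharge of
the named fact `lovettViola_goodCodes`. Proof (ECCC TR10-115, §2 and §4): with `p = 8/k`, Lemma 4
(through Claim 8, Corollary 7 and the noise isoperimetric inequality, Lemma 6) gives
`NS_p(F; C) ≥ 1/32` whenever `Δ(F(U_m), U_C) ≤ 1/2`, while Lemma 5 with the AC⁰ noise-sensitivity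
bound (Lemma 9, here from Tal's Fourier-tail theorem) gives `NS_p(F; C) ≤ (n p K_n + 1/2)/d ≤
8K_n/(ρ² n) + 1/(2ρ n)` with `K_n = polylog(n)`; for large `n` these are incompatible. [cite: LovettViola2012, Theorem 1] -/
theorem lovettViola_goodCodes_holds : lovettViola_goodCodes := by
  intro t q ρ hρ
  filter_upwards [eventually_good t q hρ] with n hn m k d F C hC hcode hk hd hF
  obtain ⟨h16, hmain⟩ := hn
  by_contra hlt
  push Not at hlt
  -- parameters
  have hk16 : (16 : ℝ) ≤ k := h16.trans hk
  have hk16' : 16 ≤ k := by exact_mod_cast hk16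
  have hkpos : (0 : ℝ) < k := by linarith
  have hnpos : (0 : ℝ) < n := by
    rcases Nat.eq_zero_or_pos n with h | h
    · subst h; simp at h16; linarith
    · exact_mod_cast h
  set p : ℝ := 8 / k with hp
  have hp0 : 0 ≤ p := by positivity
  have hp12 : p ≤ 1 / 2 := by
    rw [hp, div_le_iff₀ hkpos]; linarith
  -- Lemma 4: the noise sensitivity w.r.t. `C` is large
  have hcard : (C.card : ℝ) = (2 : ℝ) ^ k := by rw [hcode.1]; push_cast; rfl
  have hsmall : ((4 : ℝ) / C.card) ^ (p / 2) ≤ 1 / 8 := by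
    rw [hcard, hp]; exact small_param (by omega)
  have h4 := lemma4 hp0 hp12 F C hC hsmall hlt.le
  -- Lemma 5: ... and small
  have hd1R : (1 : ℝ) ≤ d := le_trans (by linarith) hd
  have hd1 : 1 ≤ d := by exact_mod_cast hd1R
  have hdpos : (0 : ℝ) < d := by linarith
  have h5 := codeNS_le_sum_boolNS hp0 (by linarith) F C hd1 hcode.2
  set s := max 2 (q.eval n) with hs
  set L := Nat.log 2 n with hL
  set K : ℝ := (nsK t s L : ℝ) with hK
  have hK0 : 0 ≤ K := Nat.cast_nonneg _
  have hbit : ∀ i : Fin n, boolNS p (fun x => F x i) ≤ p * K + 1 / 2 ^ (L + 2) := fun i => by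
    obtain ⟨Ci, hover, hdepth, hsize, hcomp⟩ := hF i
    exact boolNS_circuit_le hp0 hp12 Ci hover hdepth (hsize.trans (le_max_right _ _))
      (le_trans (by norm_num) (le_max_left _ _)) _ hcomp L
  have hsum : ∑ i : Fin n, boolNS p (fun x => F x i) ≤ n * (p * K + 1 / 2 ^ (L + 2)) := by
    calc ∑ i : Fin n, boolNS p (fun x => F x i) ≤ ∑ _i : Fin n, (p * K + 1 / 2 ^ (L + 2)) :=
          Finset.sum_le_sum fun i _ => hbit i
      _ = n * (p * K + 1 / 2 ^ (L + 2)) := by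
          rw [Finset.sum_const, Finset.card_univ, Fintype.card_fin, nsmul_eq_mul]
  have hnL : (n : ℝ) < 2 ^ (L + 1) := by exact_mod_cast Nat.lt_pow_succ_log_self one_lt_two n
  have htail : (n : ℝ) * (1 / 2 ^ (L + 2)) ≤ 1 / 2 := by
    rw [pow_succ, mul_one_div, div_le_iff₀ (by positivity)]
    linarith
  -- combine
  have hup : codeNS p F C ≤ (8 * K / ρ + 1 / 2) / (ρ * n) := by
    refine h5.trans ?_
    have hnum : ∑ i : Fin n, boolNS p (fun x => F x i) ≤ 8 * K / ρ + 1 / 2 := by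
      have hnp : (n : ℝ) * p ≤ 8 / ρ := by
        rw [hp, mul_div_assoc', div_le_div_iff₀ hkpos hρ]
        nlinarith
      calc ∑ i : Fin n, boolNS p (fun x => F x i) ≤ n * (p * K + 1 / 2 ^ (L + 2)) := hsum
        _ = (n * p) * K + n * (1 / 2 ^ (L + 2)) := by ring
        _ ≤ (8 / ρ) * K + 1 / 2 := add_le_add (mul_le_mul_of_nonneg_right hnp hK0) htail
        _ = 8 * K / ρ + 1 / 2 := by ring
    have hnum0 : 0 ≤ 8 * K / ρ + 1 / 2 := by positivity
    calc (∑ i : Fin n, boolNS p (fun x => F x i)) / d ≤ (8 * K / ρ + 1 / 2) / d :=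
          div_le_div_of_nonneg_right hnum hdpos.le
      _ ≤ (8 * K / ρ + 1 / 2) / (ρ * n) := div_le_div_of_nonneg_left hnum0 (by positivity) hd
  have hfin := h4.trans hup
  rw [le_div_iff₀ (by positivity)] at hfin
  linarith

end Literature.Computability.Complexity

end
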